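import Summits.CriticalPhenomena.PercolationContinuityZ3.Theorems.PercNearOneGluingNoHeavyLowerTailSahiThreeCopyProducts

/-!
# `NoHeavyLowerTail` (crux stmt-CriticalPhenomena-4575), Sahi programme: **3C-SAHI IS CLOSED UNDER BLOCK PRODUCTS** — if `(g,g',g'')` on `{0,1}^m` and
# `(f,f',f'')` on `{0,1}^d` satisfy the three-copy Sahi inequality at profiles `b_f`, `b_b`, then the block products `(g⊗f, g'⊗f', g''⊗f'')` satisfy it at the
# concatenated profile (AND of events on disjoint blocks)

Support file (Sahi cell, seat `prim-sahi-p1`, generation 54; `--supports stmt-CriticalPhenomena-4575`); companion of `…SahiThreeCopy`, `…SahiThreeCopyLiterals`.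
Pure proofs plus two recursive bookkeeping definitions (`appendProf`, `tens`); no `sorry`, standard axioms.

* `tens m g f : {0,1}^{d+m} → ℝ`, `x ↦ g(x_0,…,x_{m−1})·f(x_m,…,x_{m+d−1})` (block/tensor product, defined by peeling the front coordinates: `tens (m+1) g f (ε,x) =
  tens m (g^ε) f x`), `appendProf m b_f b_b` the concatenated profile.
* ★ `N3_tens`: **the three-copy functional FACTORISES over blocks**: `N_{(b_f,b_b)}(g⊗f; g'⊗f'; g''⊗f'') = N_{b_f}(g;g';g'')·N_{b_b}(f;f';f'')` (induction on `m` with the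
  slice recursion `N3_cons` on both sides).
* ★★ `tc_tens_nonneg` (BLOCK-AND CLOSURE): for nonnegative monotone sextuples with `0 ≤ c_{b_f}(g,g',g'')` and `0 ≤ c_{b_b}(f,f',f'')`:
  `0 ≤ c_{(b_f,b_b)}(g⊗f, g'⊗f', g''⊗f'')`.  CERTIFICATE (memo FROM-prim-sahi-p1-gen54 §3b): with the five-vectors `v = (N(gg'g''), N(g;g'g''), N(g';gg''), N(g'';gg'), N(g;g';g''))`,
  `w` likewise, `c(v⊙w) = v₃·c(w) + w₀·c(v) + Σ_I (v_I − v₃)(w₀ − w_I)`, all factors nonnegative by three-copy Harris (`N(gg'g'') ≥ N(g;g'g'') ≥ N(g;g';g'')`).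
  `tc_tens_nonneg_all`: every profile of `{0,1}^{d+m}` is a concatenation, so "3C-SAHI at all profiles" is closed under block-AND; events form: `(A₁×A₂, B₁×B₂, C₁×C₂)`.
So the class of triples satisfying the census conjecture 3C-SAHI (CENSUS §175 W197) at every profile is closed under products of triples on disjoint blocks (the
AND-literal step of `…Literals` is the case `m = 1` with `(g,g',g'')` coordinate literals).  The block-OR analogue holds on paper (memo §3, via the OR-cone / a transport lemma)
and is not typed here. [this work; conjecture: CENSUS §175 W197 (prim-sahi-census gen 54)]
-/

namespace Summit.CriticalPhenomena.PercolationContinuityZ3.Theorems.SahiThreeCopy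

open Finset Function Literature.Combinatorics.Sahi2008
open scoped BigOperators

noncomputable section

variable {d : ℕ}

/-! ### §1 Concatenated profiles and block products -/

/-- The concatenated profile: `m` front entries `b_f`, then the `d` entries of `b_b`. [this work] -/
def appendProf : (m : ℕ) → (Fin m → ℕ) → (Fin d → ℕ) → (Fin (d + m) → ℕ)
  | 0, _, bb => bb
  | m + 1, bf, bb => Fin.cons (bf 0) (appendProf m (Fin.tail bf) bb)

/-- The BLOCK (tensor) PRODUCT `(g ⊗ f)(x) = g(front m coordinates)·f(back d coordinates)`, defined by peeling front coordinates. [this work] -/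
def tens : (m : ℕ) → (Pt m → ℝ) → (Pt d → ℝ) → (Pt (d + m) → ℝ)
  | 0, g, f => g (fun i => Fin.elim0 i) • f
  | m + 1, g, f => fun x => tens m (sec g (x 0)) f (Fin.tail x)

/-- Sections of a block product along the first front coordinate. [this work] -/
theorem sec_tens (m : ℕ) (g : Pt (m + 1) → ℝ) (f : Pt d → ℝ) (ε : Bool) : sec (tens (m + 1) g f) ε = tens m (sec g ε) f := by
  funext x; simp [sec, tens, Fin.cons_zero, Fin.tail_cons]

/-- Block products are multiplicative: `(g⊗f)·(g'⊗f') = (gg')⊗(ff')`. [this work] -/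
theorem tens_mul : ∀ (m : ℕ) (g g' : Pt m → ℝ) (f f' : Pt d → ℝ), tens m g f * tens m g' f' = tens m (g * g') (f * f')
  | 0, g, g', f, f' => by
    funext x; simp only [tens, Pi.mul_apply, Pi.smul_apply, smul_eq_mul]; ring
  | m + 1, g, g', f, f' => by
    funext x
    have h := congrFun (tens_mul m (sec g (x 0)) (sec g' (x 0)) f f') (Fin.tail x)
    simp only [Pi.mul_apply] at h
    simp only [tens, Pi.mul_apply, sec_mul]
    exact h

/-- `1 ⊗ 1 = 1`. [this work] -/
theorem tens_one : ∀ m : ℕ, tens m (1 : Pt m → ℝ) (1 : Pt d → ℝ) = 1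
  | 0 => by funext x; simp [tens]
  | m + 1 => by funext x; simp only [tens, sec_one, tens_one m, Pi.one_apply]

/-- Block products of nonnegative functions are nonnegative. [this work] -/
theorem tens_nonneg : ∀ (m : ℕ) {g : Pt m → ℝ} {f : Pt d → ℝ}, (∀ y, 0 ≤ g y) → (∀ x, 0 ≤ f x) → ∀ x, 0 ≤ tens m g f x
  | 0, _, _, hg, hf, x => by simp only [tens, Pi.smul_apply, smul_eq_mul]; exact mul_nonneg (hg _) (hf x)
  | m + 1, _, _, hg, hf, x => by simp only [tens]; exact tens_nonneg m (sec_nonneg hg _) hf _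

/-- Block products of nonnegative monotone functions are monotone. [this work] -/
theorem tens_monotone : ∀ (m : ℕ) {g : Pt m → ℝ} {f : Pt d → ℝ}, (∀ y, 0 ≤ g y) → Monotone g → (∀ x, 0 ≤ f x) → Monotone f →
    Monotone (tens m g f)
  | 0, g, f, hg, _, hf, hfm => by
    intro x y hxy; simp only [tens, Pi.smul_apply, smul_eq_mul]; exact mul_le_mul_of_nonneg_left (hfm hxy) (hg _)
  | m + 1, g, f, hg, hgm, hf, hfm => by
    intro x y hxy
    have ht : Fin.tail x ≤ Fin.tail y := fun i => hxy i.succ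
    simp only [tens]
    calc tens m (sec g (x 0)) f (Fin.tail x) ≤ tens m (sec g (x 0)) f (Fin.tail y) :=
          tens_monotone m (sec_nonneg hg _) (sec_monotone hgm _) hf hfm ht
      _ ≤ tens m (sec g (y 0)) f (Fin.tail y) := by
          -- monotone in the front section: sec g (x 0) ≤ sec g (y 0) pointwise
          have hsec : ∀ z, sec g (x 0) z ≤ sec g (y 0) z := fun z => hgm (Fin.cons_le_cons.2 ⟨hxy 0, le_rfl⟩)
          exact tens_mono_front m hsec hf (Fin.tail y)
where
  /-- pointwise monotonicity of `tens` in the front factor (auxiliary). [this work] -/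
  tens_mono_front : ∀ (m : ℕ) {g₁ g₂ : Pt m → ℝ} {f : Pt d → ℝ}, (∀ z, g₁ z ≤ g₂ z) → (∀ x, 0 ≤ f x) → ∀ x, tens m g₁ f x ≤ tens m g₂ f x
  | 0, _, _, _, hg, hf, x => by simp only [tens, Pi.smul_apply, smul_eq_mul]; exact mul_le_mul_of_nonneg_right (hg _) (hf x)
  | m + 1, _, _, _, hg, hf, x => by simp only [tens]; exact tens_mono_front m (fun z => hg _) hf _

/-! ### §2 Factorisation of the three-copy functional over blocks -/

/-- ★ **`N_{(b_f,b_b)}(g⊗f; g'⊗f'; g''⊗f'') = N_{b_f}(g;g';g'')·N_{b_b}(f;f';f'')`.** [this work] -/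
theorem N3_tens : ∀ (m : ℕ) (bf : Fin m → ℕ) (bb : Fin d → ℕ) (g g' g'' : Pt m → ℝ) (f f' f'' : Pt d → ℝ),
    N3 (appendProf m bf bb) (tens m g f) (tens m g' f') (tens m g'' f'') = N3 bf g g' g'' * N3 bb f f' f''
  | 0, bf, bb, g, g', g'', f, f', f'' => by
    simp only [appendProf, tens, N3_smul_left, N3_smul_mid, N3_smul_right, N3_dim_zero]
    ring
  | m + 1, bf, bb, g, g', g'', f, f', f'' => by
    have hbf : bf = Fin.cons (bf 0) (Fin.tail bf) := (Fin.cons_self_tail bf).symm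
    conv_rhs => rw [hbf, N3_cons]
    simp only [appendProf]
    rw [N3_cons]
    simp only [sec_tens, N3_tens m, sum_mul]
    refine sum_congr rfl fun ε₁ _ => sum_congr rfl fun ε₂ _ => sum_congr rfl fun ε₃ _ => ?_
    split_ifs <;> ring

/-- Every profile of `{0,1}^{d+m}` is a concatenation. [this work] -/
theorem exists_appendProf : ∀ (m : ℕ) (b : Fin (d + m) → ℕ), ∃ (bf : Fin m → ℕ) (bb : Fin d → ℕ), b = appendProf m bf bb
  | 0, b => ⟨fun i => Fin.elim0 i, b, rfl⟩
  | m + 1, b => by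
    obtain ⟨bf, bb, h⟩ := exists_appendProf m (Fin.tail b)
    refine ⟨Fin.cons (b 0) bf, bb, ?_⟩
    simp only [appendProf, Fin.cons_zero, Fin.tail_cons]
    rw [← h]
    exact (Fin.cons_self_tail b).symm

/-! ### §3 Block-AND closure of 3C-SAHI -/

/-- The AND-closure certificate on five-vectors: `c(v⊙w) = v₃·c(w) + w₀·c(v) + Σ_I (v_I − v₃)(w₀ − w_I)` gives `c(v⊙w) ≥ 0` from `c(v), c(w) ≥ 0` and the
Harris chains `v₀ ≥ v_I ≥ v₃ ≥ 0`, `w₀ ≥ w_I ≥ w₃ ≥ 0`. [this work] -/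
theorem blockAnd_key_ineq {v0 vA vB vC v3 w0 wA wB wC w3 : ℝ} (hv : 0 ≤ 2 * v0 - (vA + vB + vC) + v3) (hw : 0 ≤ 2 * w0 - (wA + wB + wC) + w3)
    (hv3 : 0 ≤ v3) (hw0 : 0 ≤ w0) (hvA : v3 ≤ vA) (hvB : v3 ≤ vB) (hvC : v3 ≤ vC) (hwA : wA ≤ w0) (hwB : wB ≤ w0) (hwC : wC ≤ w0) :
    0 ≤ 2 * (v0 * w0) - (vA * wA + vB * wB + vC * wC) + v3 * w3 := by
  nlinarith [mul_nonneg hv3 hw, mul_nonneg hw0 hv, mul_nonneg (sub_nonneg.2 hvA) (sub_nonneg.2 hwA),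
    mul_nonneg (sub_nonneg.2 hvB) (sub_nonneg.2 hwB), mul_nonneg (sub_nonneg.2 hvC) (sub_nonneg.2 hwC)]

/-- Three-copy Harris, form `N_b(f;gh;1) ≤ N_b(fgh;1;1)`. [this work] -/
theorem N3_split_le (b : Fin d → ℕ) {f g h : Pt d → ℝ} (hf : ∀ x, 0 ≤ f x) (hfm : Monotone f) (hg : ∀ x, 0 ≤ g x) (hgm : Monotone g)
    (hh : ∀ x, 0 ≤ h x) (hhm : Monotone h) : N3 b f (g * h) 1 ≤ N3 b (f * g * h) 1 1 := by
  have := N3_le_N3_mul d b f (g * h) 1 hf hfm (fun x => mul_nonneg (hg x) (hh x)) (hgm.mul hhm hg hh) fun _ => zero_le_one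
  rwa [← mul_assoc] at this

/-- Three-copy Harris with spectator, form `N_b(f;g;h) ≤ N_b(f;gh;1)`. [this work] -/
theorem N3_split3_le (b : Fin d → ℕ) {f g h : Pt d → ℝ} (hf : ∀ x, 0 ≤ f x) (hg : ∀ x, 0 ≤ g x) (hgm : Monotone g)
    (hh : ∀ x, 0 ≤ h x) (hhm : Monotone h) : N3 b f g h ≤ N3 b f (g * h) 1 := by
  have := N3_le_N3_mul d b g h f hg hgm hh hhm hf
  rw [N3_comm12 b f g h, N3_comm23 b g f h, N3_comm13 b f (g * h) 1, N3_comm12 b 1 (g * h) f]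
  exact this

/-- ★★ **BLOCK-AND CLOSURE OF 3C-SAHI.**  Nonnegative monotone `g, g', g''` on `{0,1}^m` and `f, f', f''` on `{0,1}^d` with `0 ≤ c_{b_f}(g,g',g'')` and
`0 ≤ c_{b_b}(f,f',f'')` give `0 ≤ c_{(b_f,b_b)}(g⊗f, g'⊗f', g''⊗f'')`. [this work] -/
theorem tc_tens_nonneg (m : ℕ) (bf : Fin m → ℕ) (bb : Fin d → ℕ) {g g' g'' : Pt m → ℝ} {f f' f'' : Pt d → ℝ}
    (hg : ∀ y, 0 ≤ g y) (hgm : Monotone g) (hg' : ∀ y, 0 ≤ g' y) (hg'm : Monotone g') (hg'' : ∀ y, 0 ≤ g'' y) (hg''m : Monotone g'')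
    (hf : ∀ x, 0 ≤ f x) (hfm : Monotone f) (hf' : ∀ x, 0 ≤ f' x) (hf'm : Monotone f') (hf'' : ∀ x, 0 ≤ f'' x) (hf''m : Monotone f'')
    (htg : 0 ≤ tc bf g g' g'') (htf : 0 ≤ tc bb f f' f'') :
    0 ≤ tc (appendProf m bf bb) (tens m g f) (tens m g' f') (tens m g'' f'') := by
  unfold tc at htg htf ⊢
  simp only [tens_mul]
  rw [← tens_one m]
  simp only [N3_tens]
  have vA := N3_split_le bf hg hgm hg' hg'm hg'' hg''m
  have vB : N3 bf g' (g * g'') 1 ≤ N3 bf (g * g' * g'') 1 1 := by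
    have := N3_split_le bf hg' hg'm hg hgm hg'' hg''m; rwa [mul_comm g' g] at this
  have vC : N3 bf g'' (g * g') 1 ≤ N3 bf (g * g' * g'') 1 1 := by
    have := N3_split_le bf hg'' hg''m hg hgm hg' hg'm; rwa [mul_comm g'' g, mul_right_comm g g'' g'] at this
  have wA := N3_split_le bb hf hfm hf' hf'm hf'' hf''m
  have wB : N3 bb f' (f * f'') 1 ≤ N3 bb (f * f' * f'') 1 1 := by
    have := N3_split_le bb hf' hf'm hf hfm hf'' hf''m; rwa [mul_comm f' f] at this
  have wC : N3 bb f'' (f * f') 1 ≤ N3 bb (f * f' * f'') 1 1 := by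
    have := N3_split_le bb hf'' hf''m hf hfm hf' hf'm; rwa [mul_comm f'' f, mul_right_comm f f'' f'] at this
  have v3A := N3_split3_le bf hg hg' hg'm hg'' hg''m
  have v3B : N3 bf g g' g'' ≤ N3 bf g' (g * g'') 1 := by
    have := N3_split3_le bf hg' hg hgm hg'' hg''m; rwa [N3_comm12 bf g' g g''] at this
  have v3C : N3 bf g g' g'' ≤ N3 bf g'' (g * g') 1 := by
    have := N3_split3_le bf hg'' hg hgm hg' hg'm; rwa [N3_comm12 bf g'' g g', N3_comm23 bf g g'' g'] at this
  have v3 : 0 ≤ N3 bf g g' g'' := N3_nonneg bf hg hg' hg''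
  have w0 : 0 ≤ N3 bb (f * f' * f'') 1 1 :=
    N3_nonneg bb (fun x => mul_nonneg (mul_nonneg (hf x) (hf' x)) (hf'' x)) (fun _ => zero_le_one) fun _ => zero_le_one
  have key := blockAnd_key_ineq htg htf v3 w0 v3A v3B v3C wA wB wC
  nlinarith [key]

/-- **Block-AND closure at all profiles**: if the two triples satisfy 3C-SAHI at EVERY profile of their blocks, so does the block product at every profile of
`{0,1}^{d+m}`. [this work] -/
theorem tc_tens_nonneg_all (m : ℕ) {g g' g'' : Pt m → ℝ} {f f' f'' : Pt d → ℝ}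
    (hg : ∀ y, 0 ≤ g y) (hgm : Monotone g) (hg' : ∀ y, 0 ≤ g' y) (hg'm : Monotone g') (hg'' : ∀ y, 0 ≤ g'' y) (hg''m : Monotone g'')
    (hf : ∀ x, 0 ≤ f x) (hfm : Monotone f) (hf' : ∀ x, 0 ≤ f' x) (hf'm : Monotone f') (hf'' : ∀ x, 0 ≤ f'' x) (hf''m : Monotone f'')
    (htg : ∀ bf, 0 ≤ tc bf g g' g'') (htf : ∀ bb, 0 ≤ tc bb f f' f'') (b : Fin (d + m) → ℕ) :
    0 ≤ tc b (tens m g f) (tens m g' f') (tens m g'' f'') := by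
  obtain ⟨bf, bb, rfl⟩ := exists_appendProf m b
  exact tc_tens_nonneg m bf bb hg hgm hg' hg'm hg'' hg''m hf hfm hf' hf'm hf'' hf''m (htg bf) (htf bb)

/-- Events form: for up-sets `A₁, B₁, C₁ ⊆ {0,1}^m` and `A₂, B₂, C₂ ⊆ {0,1}^d` satisfying 3C-SAHI (events form) at all profiles, the product events
`A₁ × A₂` etc. (`1_{A₁×A₂} = 1_{A₁} ⊗ 1_{A₂}`) satisfy it at all profiles. [this work] -/
theorem tc_tens_setInd_nonneg (m : ℕ) {A₁ B₁ C₁ : Finset (Pt m)} {A₂ B₂ C₂ : Finset (Pt d)} (hA₁ : IsUpperSet (A₁ : Set (Pt m)))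
    (hB₁ : IsUpperSet (B₁ : Set (Pt m))) (hC₁ : IsUpperSet (C₁ : Set (Pt m))) (hA₂ : IsUpperSet (A₂ : Set (Pt d)))
    (hB₂ : IsUpperSet (B₂ : Set (Pt d))) (hC₂ : IsUpperSet (C₂ : Set (Pt d))) (h₁ : ∀ bf, 0 ≤ tc bf (setInd A₁) (setInd B₁) (setInd C₁))
    (h₂ : ∀ bb, 0 ≤ tc bb (setInd A₂) (setInd B₂) (setInd C₂)) (b : Fin (d + m) → ℕ) :
    0 ≤ tc b (tens m (setInd A₁) (setInd A₂)) (tens m (setInd B₁) (setInd B₂)) (tens m (setInd C₁) (setInd C₂)) :=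
  tc_tens_nonneg_all m (setInd_nonneg _) (monotone_setInd hA₁) (setInd_nonneg _) (monotone_setInd hB₁) (setInd_nonneg _) (monotone_setInd hC₁)
    (setInd_nonneg _) (monotone_setInd hA₂) (setInd_nonneg _) (monotone_setInd hB₂) (setInd_nonneg _) (monotone_setInd hC₂) h₁ h₂ b

end

end Summit.CriticalPhenomena.PercolationContinuityZ3.Theorems.SahiThreeCopy
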